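import Summits.QuantumFields.YangMills.Theorems.LuscherReductionTwistedTraceScalingCruxOfCmpTwoLoop
import HarnessLib

/-!
# The open stub CMP-2LOOP in its SMALLEST currency: the femto trace law at EVERY lattice size, threshold-free in `L`, and its WINDOW-FREE
# label-limit form — crux disprover, cycle 62 (route `LuscherReduction`, crux `TwistedTraceScaling` stmt-QuantumFields-20203; `--supports`, helper only)

After cycle 61 the crux's one remaining registered stub `TwoLattice.Stmt.stub_cmpTwoLoop` (skeleton «twolattice» rev 3, sha16 `1a2ae9b1ae61a9c5`) is, UNCONDITIONALLY,
the `lam`-uniform femto trace law UFTL (✓`TwoLattice.cmpTwoLoop_iff_uniform`, lead g24, S-BASE ✓`TwoLattice.stub_fixedLatticeTraceLaw` discharged):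

  UFTL:  `∀ s ε, ∃ L0, ∃ lam0 > 0, ∀ lam ∈ (0, lam0], ∀ L ≥ L0, ∀ β ∈ W(lam, L), |r_L(β, ⌈sL/Λ(β,L)⌉) − r_𝔥(s)| ≤ ε`.

This file removes the last two pieces of bookkeeping from that text, using only landed theorems:

* `uniform_iff_uniformAllSizes` — **the size threshold `L0` carries no content**: UFTL ⟺ UFTL₀, the same text with `∀ L ≥ 1` (no `L0`).  The finitely many sizes
  below `L0` are supplied by S-BASE (✓`TwoLattice.stub_fixedLatticeTraceLaw`) because the window forces `β ≥ 1/(4 lam³)` (✓`BOHandover.beta_ge_of_window`): one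
  descent step per size (`uniformFrom_pred`), iterated (`uniformAllSizes_of_uniformFrom`).
* `uniformAllSizes_iff_labelLimit` — **the dyadic windows carry no content either**: UFTL₀ ⟺ the WINDOW-FREE label limit
  LIM:  `∀ s ε, ∃ Λ0 > 0, ∀ L ≥ 1, ∀ β ≥ 1, 0 < Λ(β, L) ≤ Λ0 → |r_L(β, ⌈sL/Λ(β,L)⌉) − r_𝔥(s)| ≤ ε`
  (the union of the windows `[lam, 2lam]`, `lam ≤ lam0`, is `(0, 2 lam0]`; conversely `Λ ∈ (0, Λ0]` lies in the window of depth `Λ/2`).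
* ★★ `cmpTwoLoop_iff_uniformAllSizes`, ★★★ `cmpTwoLoop_iff_labelLimit` — hence **`Stmt.stub_cmpTwoLoop` ⟺ LIM**: the registered XL stub, stated over two-loop calibrators
  `φ`, block pairs `(b, k)`, tolerances `δ`, calibrated times `T` and base couplings `β₁`, is EXACTLY the statement that the zero-flux dyadic trace ratio of Wilson's
  `SU(2)` theory on `(ℤ/L)³` at `⌈sL/Λ⌉` transfer steps tends to Lüscher's `r_𝔥(s)` as the two-loop label parameter `Λ(β, L) → 0`, UNIFORMLY IN THE LATTICE SIZE `L ≥ 1`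
  on the weak branch `β ≥ 1`.  No `M`, `b`, `k`, `φ`, `δ`, `T`, `β₁`, `L0`, `lam` survive.

Design consequences (negative side, for the planner of a rev 4): (i) LIM is the natural replacement text for `stub_cmpTwoLoop` (same content, kernel-certified here);
(ii) the crux itself is ⟺ FTL (✓`Tower.twistedTraceScaling_iff_femtoTraceLaw`: `∃ lam0 ∀ lam ∃ L0(lam) ∀ L ≥ L0(lam)`), so the registered stub exceeds the crux by EXACTLY the
`lam`-independence of the size threshold — abstractly FTL ∧ S-BASE ⇏ LIM (S-BASE's `β`-thresholds are `L`-dependent; cf. ✓`Negative.towerE1NonUniform_of_femtoTraceLaw`),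
and that uniformity is the RG content (W-REP + W-CMP + the two-loop law of the true flow; not in print); (iii) every guard already certified load-bearing for the crux
(`ε > 0`, window branch `1 ≤ β`, threshold kept — ✓`Negative.twistedTraceScaling_false_without_*`) is a fortiori load-bearing for LIM.
HONEST FRAMING: compositions of landed theorems; LIM ≡ UFTL ≡ CMP-2LOOP is OPEN; the crux `TwistedTraceScaling` is NOT closed; the route R2b1 (Lüscher two-lattice reduction)
is CONDITIONAL; fixed-lattice statements only — not infinite volume, not a mass gap, not Clay.  No definitions, no `sorry`.
-/

set_option autoImplicit false

noncomputable section

open MeasureTheory Filter Topology Real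
open scoped BigOperators
open Literature.MathematicalPhysics.QuantumFieldTheory hiding SU2
open Summit.QuantumFields.YangMills.Theorems.FemtoTransferGap
open Summit.QuantumFields.YangMills.Theorems.FemtoTransferGap.TraceDoor
open Summit.QuantumFields.YangMills.Theorems.FemtoTransferGap.TwoLattice

namespace Summit.QuantumFields.YangMills.Theorems.TwistedTraceScaling.Negative.R75

/-! ## §1 Descent of the size threshold through S-BASE -/

/-- **One descent step.**  If the femto trace law at `(s, ε)` holds with one depth `lam0` for all sizes `L ≥ n + 1`, it holds with one (smaller) depth for all sizes
`L ≥ n`: for `n ≥ 1` the size `L = n` is S-BASE's (✓`TwoLattice.stub_fixedLatticeTraceLaw n s ε` gives a threshold `β₁`, met in every window of depth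
`lam ≤ min(1, 1/(4·max β₁ 1))` since there `β ≥ 1/(4lam³)`, ✓`BOHandover.beta_ge_of_window`, ✓`Tower.le_of_lam_small`); for `n = 0` there is nothing to add (`L ≠ 0`).
[cite: Luscher1983, §3] -/
theorem uniformFrom_pred {s ε : ℝ} (hs : 0 < s) (hε : 0 < ε) {n : ℕ}
    (h : ∃ lam0 : ℝ, 0 < lam0 ∧ ∀ lam : ℝ, 0 < lam → lam ≤ lam0 →
      ∀ (L : ℕ) [NeZero L], n + 1 ≤ L → ∀ β : ℝ, InFemtoWindow lam β L →
        |traceRatio L β (femtoSteps s β L) - hTraceRatio s| ≤ ε) :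
    ∃ lam0 : ℝ, 0 < lam0 ∧ ∀ lam : ℝ, 0 < lam → lam ≤ lam0 →
      ∀ (L : ℕ) [NeZero L], n ≤ L → ∀ β : ℝ, InFemtoWindow lam β L →
        |traceRatio L β (femtoSteps s β L) - hTraceRatio s| ≤ ε := by
  obtain ⟨lam0, hlam0, H⟩ := h
  rcases Nat.eq_zero_or_pos n with hn | hn
  · subst hn
    refine ⟨lam0, hlam0, fun lam hlam hle L _ _ β hW => H lam hlam hle L ?_ β hW⟩
    exact Nat.one_le_iff_ne_zero.mpr (NeZero.ne L)
  · haveI : NeZero n := ⟨hn.ne'⟩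
    obtain ⟨β1, hβ1⟩ := stub_fixedLatticeTraceLaw n s hs ε hε
    set B : ℝ := max β1 1 with hB
    have hBpos : 0 < B := lt_of_lt_of_le one_pos (le_max_right _ _)
    refine ⟨min lam0 (min 1 (1 / (4 * B))), lt_min hlam0 (lt_min one_pos (by positivity)), ?_⟩
    intro lam hlam hle L _ hL β hW
    rcases Nat.lt_or_ge n L with hlt | hge
    · exact H lam hlam (hle.trans (min_le_left _ _)) L hlt β hW
    · have hLn : L = n := le_antisymm hge hL
      subst hLn
      have h1 : lam ≤ 1 := (hle.trans (min_le_right _ _)).trans (min_le_left _ _)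
      have h4 : lam ≤ 1 / (4 * B) := (hle.trans (min_le_right _ _)).trans (min_le_right _ _)
      have hBle : B ≤ 1 / (4 * lam ^ 3) := Tower.le_of_lam_small hlam h1 hBpos h4
      exact hβ1 β ((le_max_left _ _).trans (hBle.trans (BOHandover.beta_ge_of_window hlam hW)))

/-- **Full descent**: a size threshold `n` in the uniform femto trace law at `(s, ε)` can be lowered to none at all (`n` applications of `uniformFrom_pred`). [folklore] -/
theorem uniformAllSizes_of_uniformFrom {s ε : ℝ} (hs : 0 < s) (hε : 0 < ε) : ∀ n : ℕ,
    (∃ lam0 : ℝ, 0 < lam0 ∧ ∀ lam : ℝ, 0 < lam → lam ≤ lam0 →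
      ∀ (L : ℕ) [NeZero L], n ≤ L → ∀ β : ℝ, InFemtoWindow lam β L →
        |traceRatio L β (femtoSteps s β L) - hTraceRatio s| ≤ ε) →
    ∃ lam0 : ℝ, 0 < lam0 ∧ ∀ lam : ℝ, 0 < lam → lam ≤ lam0 →
      ∀ (L : ℕ) [NeZero L], ∀ β : ℝ, InFemtoWindow lam β L →
        |traceRatio L β (femtoSteps s β L) - hTraceRatio s| ≤ ε
  | 0, h => by
    obtain ⟨lam0, hlam0, H⟩ := h
    exact ⟨lam0, hlam0, fun lam hlam hle L _ β hW => H lam hlam hle L (Nat.zero_le _) β hW⟩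
  | n + 1, h => uniformAllSizes_of_uniformFrom hs hε n (uniformFrom_pred hs hε h)

/-! ## §2 UFTL ⟺ UFTL₀ (no size threshold) ⟺ LIM (no windows) -/

/-- ★ **The size threshold of the uniform femto trace law carries no content**: UFTL (hypothesis/conclusion text of ✓`TwoLattice.cmpTwoLoop_iff_uniform`, verbatim) ⟺ the same law
asserted at EVERY lattice size `L ≥ 1` with one depth `lam0(s, ε)` (S-BASE supplies the sizes below `L0`). [cite: Luscher1983, §3] -/
theorem uniform_iff_uniformAllSizes :
    (∀ s : ℝ, 0 < s → ∀ ε : ℝ, 0 < ε → ∃ L0 : ℕ, ∃ lam0 : ℝ, 0 < lam0 ∧ ∀ lam : ℝ, 0 < lam → lam ≤ lam0 →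
      ∀ (L : ℕ) [NeZero L], L0 ≤ L → ∀ β : ℝ, InFemtoWindow lam β L →
        |traceRatio L β (femtoSteps s β L) - hTraceRatio s| ≤ ε) ↔
    (∀ s : ℝ, 0 < s → ∀ ε : ℝ, 0 < ε → ∃ lam0 : ℝ, 0 < lam0 ∧ ∀ lam : ℝ, 0 < lam → lam ≤ lam0 →
      ∀ (L : ℕ) [NeZero L], ∀ β : ℝ, InFemtoWindow lam β L →
        |traceRatio L β (femtoSteps s β L) - hTraceRatio s| ≤ ε) := by
  constructor
  · intro h s hs ε hε
    obtain ⟨L0, hL0⟩ := h s hs ε hε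
    exact uniformAllSizes_of_uniformFrom hs hε L0 hL0
  · intro h s hs ε hε
    obtain ⟨lam0, hlam0, H⟩ := h s hs ε hε
    exact ⟨0, lam0, hlam0, fun lam hlam hle L _ _ β hW => H lam hlam hle L β hW⟩

/-- ★ **The dyadic windows carry no content**: the threshold-free uniform law UFTL₀ ⟺ the WINDOW-FREE label limit LIM — `r_L(β, ⌈sL/Λ(β,L)⌉) → r_𝔥(s)` as the two-loop label
parameter `Λ(β, L) → 0`, uniformly in `L ≥ 1` and `β ≥ 1` (`⋃_{lam ≤ lam0} [lam, 2lam] = (0, 2lam0]`; `Λ ∈ (0, Λ0]` is in the window of depth `Λ/2`). [cite: LuscherMunster1984, §2] -/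
theorem uniformAllSizes_iff_labelLimit :
    (∀ s : ℝ, 0 < s → ∀ ε : ℝ, 0 < ε → ∃ lam0 : ℝ, 0 < lam0 ∧ ∀ lam : ℝ, 0 < lam → lam ≤ lam0 →
      ∀ (L : ℕ) [NeZero L], ∀ β : ℝ, InFemtoWindow lam β L →
        |traceRatio L β (femtoSteps s β L) - hTraceRatio s| ≤ ε) ↔
    (∀ s : ℝ, 0 < s → ∀ ε : ℝ, 0 < ε → ∃ Λ0 : ℝ, 0 < Λ0 ∧
      ∀ (L : ℕ) [NeZero L], ∀ β : ℝ, 1 ≤ β → 0 < luscherLambda β L → luscherLambda β L ≤ Λ0 →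
        |traceRatio L β (femtoSteps s β L) - hTraceRatio s| ≤ ε) := by
  constructor
  · intro h s hs ε hε
    obtain ⟨lam0, hlam0, H⟩ := h s hs ε hε
    refine ⟨lam0, hlam0, fun L _ β hβ hpos hle => ?_⟩
    exact H (luscherLambda β L / 2) (by positivity) (by linarith) L β ⟨hβ, by linarith, by linarith⟩
  · intro h s hs ε hε
    obtain ⟨Λ0, hΛ0, H⟩ := h s hs ε hε
    refine ⟨Λ0 / 2, by positivity, fun lam hlam hle L _ β hW => ?_⟩
    exact H L β hW.1 (luscherLambda_pos_of_window hlam hW) (by linarith [hW.2.2])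

/-! ## §3 The registered stub in its smallest currencies -/

/-- ★★ **CMP-2LOOP ⟺ UFTL₀** (the femto trace law at every lattice size with one depth): ✓`TwoLattice.cmpTwoLoop_iff_uniform` followed by `uniform_iff_uniformAllSizes`.
[cite: Luscher1983, §3] [cite: Balaban1989LargeFieldII, pp. 355–6] -/
theorem cmpTwoLoop_iff_uniformAllSizes :
    Stmt.stub_cmpTwoLoop ↔
    (∀ s : ℝ, 0 < s → ∀ ε : ℝ, 0 < ε → ∃ lam0 : ℝ, 0 < lam0 ∧ ∀ lam : ℝ, 0 < lam → lam ≤ lam0 →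
      ∀ (L : ℕ) [NeZero L], ∀ β : ℝ, InFemtoWindow lam β L →
        |traceRatio L β (femtoSteps s β L) - hTraceRatio s| ≤ ε) :=
  cmpTwoLoop_iff_uniform.trans uniform_iff_uniformAllSizes

/-- ★★★ **CMP-2LOOP ⟺ LIM — the registered XL stub `Stmt.stub_cmpTwoLoop` IS the window-free, threshold-free label limit**
`∀ s ε, ∃ Λ0 > 0, ∀ L ≥ 1, ∀ β ≥ 1, 0 < Λ(β,L) ≤ Λ0 → |r_L(β, ⌈sL/Λ(β,L)⌉) − r_𝔥(s)| ≤ ε`: Lüscher's zero-mode trace asymptotics on the approach `Λ(β, L) → 0` to the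
small-volume continuum limit, UNIFORMLY in the lattice size (the RG statement; W-REP + W-CMP + the two-loop law of the true flow, not in print).  Candidate replacement text for a
skeleton rev 4 (same content as the registered stub, certified here). [cite: Luscher1983, §3] [cite: LuscherMunster1984, §2] [cite: Balaban1989LargeFieldII, pp. 355–6] -/
theorem cmpTwoLoop_iff_labelLimit :
    Stmt.stub_cmpTwoLoop ↔
    (∀ s : ℝ, 0 < s → ∀ ε : ℝ, 0 < ε → ∃ Λ0 : ℝ, 0 < Λ0 ∧
      ∀ (L : ℕ) [NeZero L], ∀ β : ℝ, 1 ≤ β → 0 < luscherLambda β L → luscherLambda β L ≤ Λ0 →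
        |traceRatio L β (femtoSteps s β L) - hTraceRatio s| ≤ ε) :=
  cmpTwoLoop_iff_uniformAllSizes.trans uniformAllSizes_iff_labelLimit

/-- The crux's own currency FTL (right-hand side of ✓`Tower.twistedTraceScaling_iff_femtoTraceLaw`, verbatim) from LIM, with `lam0 := Λ0/2` and `L0 := 0`: the registered stub exceeds
the crux by exactly the `lam`-independence of the size threshold. [folklore] -/
theorem femtoTraceLaw_of_labelLimit
    (h : ∀ s : ℝ, 0 < s → ∀ ε : ℝ, 0 < ε → ∃ Λ0 : ℝ, 0 < Λ0 ∧
      ∀ (L : ℕ) [NeZero L], ∀ β : ℝ, 1 ≤ β → 0 < luscherLambda β L → luscherLambda β L ≤ Λ0 →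
        |traceRatio L β (femtoSteps s β L) - hTraceRatio s| ≤ ε) :
    ∀ s : ℝ, 0 < s → ∀ ε : ℝ, 0 < ε → ∃ lam0 : ℝ, 0 < lam0 ∧ ∀ lam : ℝ, 0 < lam → lam ≤ lam0 →
      ∃ L0 : ℕ, ∀ (L : ℕ) [NeZero L], L0 ≤ L → ∀ β : ℝ, InFemtoWindow lam β L →
        |traceRatio L β (femtoSteps s β L) - hTraceRatio s| ≤ ε := by
  intro s hs ε hε
  obtain ⟨lam0, hlam0, H⟩ := (uniformAllSizes_iff_labelLimit.2 h) s hs ε hε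
  exact ⟨lam0, hlam0, fun lam hlam hle => ⟨0, fun L _ _ β hW => H lam hlam hle L β hW⟩⟩

end Summit.QuantumFields.YangMills.Theorems.TwistedTraceScaling.Negative.R75

end
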